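import Literature.Computability.QuantumComplexity.RectanglePolynomial
import HarnessLib

/-!
# Gharibian–Le Gall, Proposition 1 and Theorem 1: the guided local Hamiltonian problem, classically

Gharibian, Le Gall, *Dequantizing the quantum singular value transformation: hardness and
applications to quantum chemistry and the quantum PCP conjecture*, STOC 2022 / SIAM J. Comput.
(arXiv:2111.09079), **§4.3, Proposition 1** — the step from the singular-value decision procedure
of Theorem 4 (formal version; `SparseQSVTEstimation.lean`, `singularValue_decision`, with Lemma 4
plugged in by `RectanglePolynomial.lean`, `singularValue_decision_of_signApprox`) to the gapped
decision version of the guided local Hamiltonian problem, whose `2r`-fold repetition is Theorem 1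
(`thresholdScan_estimate`).  As printed:

> `GLH(k,a,b,δ)` (guided local Hamiltonian, gapped decision version).  Input: a `k`-local
> Hamiltonian `H` acting on `n` qubits such that `‖H‖ ≤ 1`; sampling-access to a vector
> `u ∈ ℂ^{2^n}` such that `‖u‖ ≤ 1`.  Promises: (i) `‖Π_H u‖ ≥ δ`; (ii) either `λ_H ≤ a` or
> `λ_H ≥ b` holds.  Goal: decide which of `λ_H ≤ a` or `λ_H ≥ b` holds.
>
> **Proposition 1.** For any constants `a, b ∈ [−1,1]` such that `a < b`, any constant
> `δ ∈ (0,1]` and any `k = O(log n)`, the problem `GLH(k,a,b,δ)` can be solved classically with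
> probability at least `1 − 1/exp(n)` in `poly(n)` time.
>
> *Proof.* … Since `H` is a `k`-local Hamiltonian, i.e., `H` is a sum of `m = poly(n)` terms …
> `H` is `m2^k`-sparse.  Since `‖H‖ ≤ 1`, all the eigenvalues of `H` are in the interval `[−1,1]`.
> The Hermitian matrix `(H+3I)/4` is thus `(m2^k+1)`-sparse, and has all its eigenvalues in the
> interval `[1/2,1]`.  In order to solve `GLH(k,a,b,δ)`, we can simply use the algorithm of
> Theorem 4 for `SV(m2^k+1, 1/2, (3+a)/4, 1/2, (b−a)/4, δ, 0)` on input `((H+3I)/4, u)`.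

(§1.2: "let `λ_H` denote its ground state energy (i.e., the smallest eigenvalue of `H`) and `V_H`
the vector space spanned by its ground states … We denote by `Π_H` the orthogonal projection onto
`V_H`.")

What is formalized (real symmetric `H`, the tree's real setting).  `shifted H = (H + 3I)/4`
(`shifted`, `shifted_mulVec`).  From `‖H‖ ≤ 1` (as `‖Hx‖² ≤ ‖x‖²` for all `x`): the quadratic
form bounds `−‖x‖² ≤ xᵀHx ≤ ‖x‖²` (`abs_quadForm_le`), `‖(H+3I)x/4‖² ≤ ‖x‖²`
(`normSq_shifted_mulVec_le`, the input condition `‖A‖ ≤ 1` of Theorem 4) and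
`xᵀ((H+3I)/4)x ≥ ‖x‖²/2` ("all its eigenvalues in `[1/2,1]`", `quadForm_shifted_ge`).  The
eigen-structure Theorem 4 speaks about — `σ_i² = singularValueSq A i`, right singular vectors
`v_i`, coefficients `α_i = ⟨v_i,u⟩` — is identified with the spectrum of `H`: `AᵀA v_i = σ_i² v_i`
(`gram_mulVec_col`), hence (positivity of `A + σ_i I`) `A v_i = σ_i v_i` (`shifted_mulVec_col`) and
`H v_i = (4σ_i − 3) v_i` (`hamiltonian_mulVec_col`): the `v_i` form an orthonormal eigenbasis of
`H` with eigenvalues `4σ_i − 3`.  Then the two promises translate exactly as the printed proof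
uses them:
* `λ_H ≤ a` with `‖Π_H u‖ ≥ δ` — stated, as in `GuidedPauliClassical.lean`, through ONE unit
  vector `g` of the eigenspace of an eigenvalue `λ ≤ a` with `⟨g,u⟩ ≥ δ` (for the ground space
  take `g = Π_H u/‖Π_H u‖`) — gives `∑_{σ_i ∈ [1/2,(3+a)/4]} α_i² ≥ δ²`, i.e. case (i) of
  `SV(·,1/2,(3+a)/4,1/2,(b−a)/4,δ,ζ)` (`window_weight_ge`: `g ⊥ v_i` unless `4σ_i − 3 = λ`,
  Parseval in the basis `v_i`, Cauchy–Schwarz);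
* `λ_H ≥ b` — stated as the operator inequality `xᵀHx ≥ b‖x‖²` for all `x` — gives
  `σ_i ≥ (3+b)/4` for every `i`, i.e. no singular value in `(0, (3+b)/4) = (t₁−θ₁, t₂+θ₂)`,
  case (ii) (`no_singularValue_in_gap`).
`guidedLocalHamiltonian_decision` is Proposition 1's algorithm with its guarantee: run the
Theorem-4 procedure (the `EST` estimator on `(A,u,u,P)` with the Lemma-4 polynomial for
`(t₁,t₂,θ₁,θ₂) = (1/2,(3+a)/4,1/2,(b−a)/4)`, `χ = δ²/3`, threshold `δ²/2`); under `λ_H ≤ a` the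
answer "`≤ δ²/2`" has weight `≤ η`, under `λ_H ≥ b` the answer "`> δ²/2`" has weight `≤ η`.

Theorem 1 assembled (last section).  `GLHest(k,ε,δ)` ("Input: a `k`-local Hamiltonian `H` …
such that `‖H‖ ≤ 1`; sampling-access to a vector `u` … such that `‖u‖ ≤ 1`. Promise:
`‖Π_H u‖ ≥ δ`. Output: an estimate `λ̂` such that `|λ̂ − λ_H| ≤ ε`"; **Theorem 1**: "For any
constants `ε, δ ∈ (0,1]` and any `k = O(log n)`, the problem `GLHest(k,ε,δ)` can be solved
classically with probability at least `1 − 1/exp(n)` in `O(poly(n))` time").  The printed proof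
runs Proposition 1's procedure on the `2r` threshold pairs `(aᵢ,bᵢ) = ((i−r−1)/r, (i−r)/r)` and
scans the answers; `groundEnergy_estimate` is exactly that algorithm on `2r` independent sample
tuples, with the guarantee that the scan output `(#{j : "λ_H ≥ b_j"} − r)/r` is within `1/r` of
`λ_H` except on outcomes of total weight `≤ 2r·η` (union bound over the runs; the logic of the scan
is `thresholdScan_estimate` of `SparseQSVTEstimation.lean`).  `λ_H` enters through a unit ground
vector `g` with `⟨g,u⟩ ≥ δ` and the minimality inequality `xᵀHx ≥ λ_H‖x‖²`.

Modelling conventions (as in the files it builds on).  Real entries; `‖H‖ ≤ 1` and `λ_H ≥ b` as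
quadratic-form / norm inequalities rather than through an eigenvalue API; the procedures are
stated with the Def.-2 oracles of `A = (H+3I)/4`, and the last section derives those from Def.-2
oracles of `H` itself (`shiftedOracle`: rescale the listed entries by `1/4`, add the diagonal pair;
width `s+1` = the printed "`(H+3I)/4` is `(m2^k+1)`-sparse"), giving
`groundEnergy_estimate_of_hamiltonianOracle` on the printed inputs; `ζ`-sampling access with any
`ζ ≤ δ²/56` (the
paper uses `ζ = 0` here); success probability as the weight of the failing outcomes `≤ η`
(`η = 1/exp(n)` in print, obtained from `q ≥ 8 ln(1/η)` medians); running time represented by the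
query counts of Lemma 3 (`∑_{k≤d} s^{2k}` per entry, `d ≥ (max deg Pᵢ')/2`, the sign-polynomial
degrees being the cited `O(log(1/ξ)/θᵢ)`).  The class-level sentences ("in `poly(n)` time",
`GLH ∈ BPP` for constant precision) live in `GuidedPauliClassical.lean` as a cited named fact and
are not discharged here (no machine model).  No named facts are introduced; everything stated is
proved.

## References
* [GharibianLegall2022] S. Gharibian, F. Le Gall, STOC 2022, 19–32, doi:10.1145/3519935.3519991
  (arXiv:2111.09079, held as `paper:arxiv-2111.09079`: §4.3 problem `GLH(k,a,b,δ)`,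
  Proposition 1 and its proof, proof of Theorem 1, chunk p0016; §1.2 problem `GLHest(k,ε,δ)`,
  Theorem 1 and `Π_H`, chunk p0005).
-/

noncomputable section

namespace Literature.Computability.QuantumComplexity

namespace SampleQuery

open Polynomial Finset Matrix Literature.Computability.Complexity

section glh

variable {N : ℕ}

/-! ### `‖H‖ ≤ 1` as quadratic-form bounds; the shifted matrix `(H+3I)/4` -/

/-- `‖v‖² = v ⬝ᵥ v`. [folklore] -/
private theorem normSq_eq_dot (v : Fin N → ℝ) : normSq v = v ⬝ᵥ v := by
  simp [normSq, dotProduct, sq]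

/-- Cauchy–Schwarz for `⬝ᵥ` in `normSq` form: `(x ⬝ᵥ y)² ≤ ‖x‖² ‖y‖²`. [folklore] -/
private theorem dot_sq_le (x y : Fin N → ℝ) : (x ⬝ᵥ y) ^ 2 ≤ normSq x * normSq y := by
  simp only [dotProduct, normSq]
  exact sum_mul_sq_le_sq_mul_sq univ x y

/-- **"Since `‖H‖ ≤ 1`, all the eigenvalues of `H` are in `[−1,1]`"** in quadratic-form language:
`|xᵀHx| ≤ ‖x‖²` whenever `‖Hx‖ ≤ ‖x‖` for all `x` (Cauchy–Schwarz).
[cite: GharibianLegall2022, §4.3 proof of Proposition 1] -/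
theorem abs_quadForm_le {H : Matrix (Fin N) (Fin N) ℝ}
    (hH1 : ∀ x : Fin N → ℝ, normSq (H *ᵥ x) ≤ normSq x) (x : Fin N → ℝ) :
    |x ⬝ᵥ (H *ᵥ x)| ≤ normSq x := by
  have hcs := dot_sq_le x (H *ᵥ x)
  have hx0 := normSq_nonneg x
  have h1 : (x ⬝ᵥ (H *ᵥ x)) ^ 2 ≤ normSq x ^ 2 := by
    calc (x ⬝ᵥ (H *ᵥ x)) ^ 2 ≤ normSq x * normSq (H *ᵥ x) := hcs
      _ ≤ normSq x * normSq x := mul_le_mul_of_nonneg_left (hH1 x) hx0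
      _ = normSq x ^ 2 := by ring
  exact abs_le_of_sq_le_sq' h1 hx0 |> fun h => abs_le.mpr h

/-- **The shifted Hamiltonian `(H + 3I)/4`.** [cite: GharibianLegall2022, §4.3 proof of
Proposition 1 ("The Hermitian matrix `(H+3I)/4`")] -/
def shifted (H : Matrix (Fin N) (Fin N) ℝ) : Matrix (Fin N) (Fin N) ℝ :=
  (1 / 4 : ℝ) • (H + (3 : ℝ) • (1 : Matrix (Fin N) (Fin N) ℝ))

/-- `((H+3I)/4) x = (Hx + 3x)/4`. [cite: GharibianLegall2022, §4.3 proof of Proposition 1] -/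
theorem shifted_mulVec (H : Matrix (Fin N) (Fin N) ℝ) (x : Fin N → ℝ) :
    shifted H *ᵥ x = (1 / 4 : ℝ) • (H *ᵥ x + (3 : ℝ) • x) := by
  rw [shifted, smul_mulVec, add_mulVec, smul_mulVec, one_mulVec]

/-- The shifted matrix is symmetric when `H` is. [cite: GharibianLegall2022, §4.3 proof of
Proposition 1 ("The Hermitian matrix `(H+3I)/4`")] -/
theorem shifted_transpose {H : Matrix (Fin N) (Fin N) ℝ} (hH : Hᵀ = H) :
    (shifted H)ᵀ = shifted H := by
  rw [shifted, transpose_smul, transpose_add, transpose_smul, transpose_one, hH]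

/-- **`‖(H+3I)/4‖ ≤ 1`** (the input condition `‖A‖ ≤ 1` of `SV`): `‖(Hx+3x)/4‖² ≤ ‖x‖²`, from
`‖Hx‖ ≤ ‖x‖` and `xᵀHx ≤ ‖x‖²`. [cite: GharibianLegall2022, §4.3 proof of Proposition 1 ("has
all its eigenvalues in the interval `[1/2,1]`")] -/
theorem normSq_shifted_mulVec_le {H : Matrix (Fin N) (Fin N) ℝ}
    (hH1 : ∀ x : Fin N → ℝ, normSq (H *ᵥ x) ≤ normSq x) (x : Fin N → ℝ) :
    normSq (shifted H *ᵥ x) ≤ normSq x := by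
  have hq := (abs_le.mp (abs_quadForm_le hH1 x)).2
  have hHx := hH1 x
  have hexp : normSq (shifted H *ᵥ x) =
      (1 / 16 : ℝ) * (normSq (H *ᵥ x) + 6 * (x ⬝ᵥ (H *ᵥ x)) + 9 * normSq x) := by
    rw [shifted_mulVec]
    simp only [normSq, dotProduct, Pi.smul_apply, Pi.add_apply, smul_eq_mul, Finset.mul_sum,
      ← Finset.sum_add_distrib]
    refine Finset.sum_congr rfl fun i _ => ?_
    simp only [mulVec, dotProduct]
    ring
  rw [hexp]
  nlinarith [normSq_nonneg x]

/-- **"all its eigenvalues in `[1/2,1]`"**, lower half, in quadratic-form language: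
`xᵀ((H+3I)/4)x ≥ ‖x‖²/2`. [cite: GharibianLegall2022, §4.3 proof of Proposition 1] -/
theorem quadForm_shifted_ge {H : Matrix (Fin N) (Fin N) ℝ}
    (hH1 : ∀ x : Fin N → ℝ, normSq (H *ᵥ x) ≤ normSq x) (x : Fin N → ℝ) :
    normSq x / 2 ≤ x ⬝ᵥ (shifted H *ᵥ x) := by
  have hq := (abs_le.mp (abs_quadForm_le hH1 x)).1
  have hexp : x ⬝ᵥ (shifted H *ᵥ x) = (1 / 4 : ℝ) * (x ⬝ᵥ (H *ᵥ x) + 3 * normSq x) := by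
    rw [shifted_mulVec, normSq_eq_dot]
    simp only [dotProduct, Pi.smul_apply, Pi.add_apply, smul_eq_mul, Finset.mul_sum,
      ← Finset.sum_add_distrib]
    refine Finset.sum_congr rfl fun i _ => ?_
    ring
  rw [hexp]
  linarith

/-! ### The right singular vectors of `A = (H+3I)/4` are an eigenbasis of `H` -/

/-- The `i`-th right singular vector `v_i` (column `i` of `V`). [cite: GharibianLegall2022, §2.2
eq. (1)] -/
def rightSingularVec (A : Matrix (Fin N) (Fin N) ℝ) (i : Fin N) : Fin N → ℝ :=
  fun j => rightSingularMatrix A j i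

/-- `α_i = ⟨v_i, u⟩`. [cite: GharibianLegall2022, §4.2 proof of Theorem 4 ("`u = ∑_i α_i v_i`")] -/
theorem singularCoeff_eq_dot (A : Matrix (Fin N) (Fin N) ℝ) (u : Fin N → ℝ) (i : Fin N) :
    singularCoeff A u i = rightSingularVec A i ⬝ᵥ u := by
  simp [singularCoeff, rightSingularVec, mulVec, dotProduct, transpose_apply]

/-- `‖v_i‖² = 1`. [cite: GharibianLegall2022, §2.2 eq. (1)] -/
theorem normSq_rightSingularVec (A : Matrix (Fin N) (Fin N) ℝ) (i : Fin N) :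
    normSq (rightSingularVec A i) = 1 :=
  normSq_rightSingular_col A i

/-- **`AᵀA v_i = σ_i² v_i`**: the columns of `V` are eigenvectors of `AᵀA` (from
`AᵀA = V diag(σ²) Vᵀ` and `VᵀV = 1`). [cite: GharibianLegall2022, §2.2 eqs. (1)–(3)] -/
theorem gram_mulVec_col (A : Matrix (Fin N) (Fin N) ℝ) (i : Fin N) :
    (Aᵀ * A) *ᵥ rightSingularVec A i = singularValueSq A i • rightSingularVec A i := by
  classical
  have hcol : rightSingularVec A i = rightSingularMatrix A *ᵥ (Pi.single i 1 : Fin N → ℝ) := by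
    funext j
    simp [rightSingularVec, mulVec, dotProduct, Pi.single_apply]
  have hAH : Aᴴ = Aᵀ := conjTranspose_eq_transpose_of_trivial A
  rw [hcol, mulVec_mulVec, ← hAH, conjTranspose_mul_self_eq, Matrix.mul_assoc,
    rightSingularMatrix_transpose_mul_self, Matrix.mul_one, ← mulVec_mulVec]
  have hdiag : diagonal (singularValueSq A) *ᵥ (Pi.single i (1 : ℝ) : Fin N → ℝ)
      = singularValueSq A i • (Pi.single i 1 : Fin N → ℝ) := by
    funext j
    rw [mulVec_diagonal]
    by_cases h : j = i
    · subst h; simp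
    · simp [h]
  rw [hdiag, mulVec_smul]

/-- For symmetric `H`: `(H x) ⬝ᵥ y = x ⬝ᵥ (H y)`. [folklore] -/
private theorem dot_mulVec_symm {H : Matrix (Fin N) (Fin N) ℝ} (hH : Hᵀ = H) (x y : Fin N → ℝ) :
    (H *ᵥ x) ⬝ᵥ y = x ⬝ᵥ (H *ᵥ y) := by
  rw [dotProduct_mulVec, ← mulVec_transpose, hH]

/-- **`A v_i = σ_i v_i`** for the symmetric positive `A = (H+3I)/4`: from `AᵀA v_i = σ_i² v_i`,
`(A + σ_i I)((A − σ_i I)v_i) = 0`, and `A + σ_i I` is injective because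
`xᵀ(A + σ_i I)x ≥ ‖x‖²/2`.  So the `σ_i` of Theorem 4 ARE the eigenvalues of `(H+3I)/4`.
[cite: GharibianLegall2022, §4.3 proof of Proposition 1 (the singular values of the Hermitian
matrix `(H+3I)/4` with spectrum in `[1/2,1]` are its eigenvalues)] -/
theorem shifted_mulVec_col {H : Matrix (Fin N) (Fin N) ℝ} (hH : Hᵀ = H)
    (hH1 : ∀ x : Fin N → ℝ, normSq (H *ᵥ x) ≤ normSq x) (i : Fin N) :
    shifted H *ᵥ rightSingularVec (shifted H) i =
      Real.sqrt (singularValueSq (shifted H) i) • rightSingularVec (shifted H) i := by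
  set A := shifted H with hA_def
  set v := rightSingularVec A i with hv_def
  set σ := Real.sqrt (singularValueSq A i) with hσ_def
  have hAt : Aᵀ = A := shifted_transpose hH
  have hσ0 : 0 ≤ σ := Real.sqrt_nonneg _
  have hσ2 : σ ^ 2 = singularValueSq A i := Real.sq_sqrt (singularValueSq_nonneg A i)
  -- y := (A − σ) v satisfies (A + σ) y = 0
  set y := A *ᵥ v - σ • v with hy_def
  have hy : A *ᵥ y + σ • y = 0 := by
    have hg := gram_mulVec_col A i
    rw [hAt, ← mulVec_mulVec] at hg
    rw [hy_def, mulVec_sub, mulVec_smul, hg, ← hσ2, smul_sub, smul_smul, sq]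
    abel
  -- positivity of A + σ kills y
  have hpos := quadForm_shifted_ge hH1 y
  have hq : y ⬝ᵥ (A *ᵥ y + σ • y) = 0 := by rw [hy, dotProduct_zero]
  rw [dotProduct_add, dotProduct_smul, smul_eq_mul, ← normSq_eq_dot] at hq
  have hy0 : normSq y = 0 := by nlinarith [normSq_nonneg y]
  have hyz : y = 0 := (normSq_eq_zero_iff y).1 hy0
  rw [hy_def, sub_eq_zero] at hyz
  exact hyz

/-- **`H v_i = (4σ_i − 3) v_i`**: the right singular basis of `(H+3I)/4` is an orthonormal
eigenbasis of `H`, eigenvalues `4σ_i − 3`. [cite: GharibianLegall2022, §4.3 proof of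
Proposition 1 (eigenvalues of `H` in `[−1,1]` ↔ eigenvalues of `(H+3I)/4` in `[1/2,1]`)] -/
theorem hamiltonian_mulVec_col {H : Matrix (Fin N) (Fin N) ℝ} (hH : Hᵀ = H)
    (hH1 : ∀ x : Fin N → ℝ, normSq (H *ᵥ x) ≤ normSq x) (i : Fin N) :
    H *ᵥ rightSingularVec (shifted H) i =
      (4 * Real.sqrt (singularValueSq (shifted H) i) - 3) • rightSingularVec (shifted H) i := by
  have h := shifted_mulVec_col hH hH1 i
  rw [shifted_mulVec] at h
  set v := rightSingularVec (shifted H) i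
  set σ := Real.sqrt (singularValueSq (shifted H) i)
  have h4 : H *ᵥ v + (3 : ℝ) • v = (4 * σ) • v := by
    have := congrArg (fun w => (4 : ℝ) • w) h
    simp only [smul_smul] at this
    norm_num at this
    exact this
  rw [sub_smul, ← h4]
  simp

/-- `σ_i = v_iᵀ A v_i` (unit eigenvector). [cite: GharibianLegall2022, §4.3 proof of Proposition 1] -/
theorem sqrt_singularValueSq_eq_quadForm {H : Matrix (Fin N) (Fin N) ℝ} (hH : Hᵀ = H)
    (hH1 : ∀ x : Fin N → ℝ, normSq (H *ᵥ x) ≤ normSq x) (i : Fin N) :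
    Real.sqrt (singularValueSq (shifted H) i) =
      rightSingularVec (shifted H) i ⬝ᵥ (shifted H *ᵥ rightSingularVec (shifted H) i) := by
  rw [shifted_mulVec_col hH hH1 i, dotProduct_smul, smul_eq_mul, ← normSq_eq_dot,
    normSq_rightSingularVec, mul_one]

/-! ### The two promises of `GLH(k,a,b,δ)` in the language of `SV` -/

/-- **Case `λ_H ≥ b` ⇒ case (ii) of `SV(·,1/2,(3+a)/4,1/2,(b−a)/4,·,·)`**: if `xᵀHx ≥ b‖x‖²` for
all `x` then every `σ_i ≥ (3+b)/4 = t₂ + θ₂`, so no singular value of `(H+3I)/4` lies in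
`(t₁ − θ₁, t₂ + θ₂) = (0, (3+b)/4)`. [cite: GharibianLegall2022, §4.3 proof of Proposition 1] -/
theorem no_singularValue_in_gap {H : Matrix (Fin N) (Fin N) ℝ} (hH : Hᵀ = H)
    (hH1 : ∀ x : Fin N → ℝ, normSq (H *ᵥ x) ≤ normSq x) {a b : ℝ}
    (hb : ∀ x : Fin N → ℝ, b * normSq x ≤ x ⬝ᵥ (H *ᵥ x)) (i : Fin N) :
    ¬ (1 / 2 - 1 / 2 < Real.sqrt (singularValueSq (shifted H) i) ∧
        Real.sqrt (singularValueSq (shifted H) i) < (3 + a) / 4 + (b - a) / 4) := by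
  set v := rightSingularVec (shifted H) i
  have hσ : Real.sqrt (singularValueSq (shifted H) i) = (v ⬝ᵥ (H *ᵥ v) + 3) / 4 := by
    rw [sqrt_singularValueSq_eq_quadForm hH hH1 i, shifted_mulVec, dotProduct_smul,
      dotProduct_add, dotProduct_smul, smul_eq_mul, smul_eq_mul, ← normSq_eq_dot,
      normSq_rightSingularVec]
    ring
  have hbv := hb v
  rw [normSq_rightSingularVec, mul_one] at hbv
  rintro ⟨-, h2⟩
  rw [hσ] at h2
  linarith

/-- **Case `λ_H ≤ a` with the overlap promise ⇒ case (i)**: if `g` is a unit vector with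
`Hg = λg`, `λ ≤ a`, and `⟨g,u⟩ ≥ δ ≥ 0`, then the weight of `u` on the right singular vectors of
`(H+3I)/4` with `σ_i ∈ [1/2, (3+a)/4]` is at least `δ²` — since `g ⊥ v_i` unless
`4σ_i − 3 = λ`, `⟨g,u⟩ = ∑_i ⟨v_i,g⟩⟨v_i,u⟩` (Parseval) runs over those `i` only, and
Cauchy–Schwarz with `∑_i ⟨v_i,g⟩² = ‖g‖² = 1` gives `δ² ≤ ⟨g,u⟩² ≤ ∑_{4σ_i−3=λ} α_i²`; finally
`λ ∈ [−1,a]` puts these `σ_i = (λ+3)/4` in `[1/2,(3+a)/4]`.  (`‖Π_H u‖ ≥ δ` is the case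
`g = Π_H u/‖Π_H u‖`, `λ = λ_H`.) [cite: GharibianLegall2022, §4.3 Proposition 1 (promise (i)
`‖Π_H u‖ ≥ δ`) and §4.2 problem `SV` (promise (i) "`‖Π^{[t₁,t₂]}_A u‖ ≥ δ`")] -/
theorem window_weight_ge {H : Matrix (Fin N) (Fin N) ℝ} (hH : Hᵀ = H)
    (hH1 : ∀ x : Fin N → ℝ, normSq (H *ᵥ x) ≤ normSq x) (u : Fin N → ℝ) {a δ lam : ℝ}
    (hδ : 0 ≤ δ) (hla : lam ≤ a) {g : Fin N → ℝ} (hg : H *ᵥ g = lam • g) (hg1 : normSq g = 1)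
    (hgu : δ ≤ g ⬝ᵥ u) :
    δ ^ 2 ≤ ∑ i ∈ univ.filter (fun i => 1 / 2 ≤ Real.sqrt (singularValueSq (shifted H) i) ∧
        Real.sqrt (singularValueSq (shifted H) i) ≤ (3 + a) / 4),
      singularCoeff (shifted H) u i ^ 2 := by
  classical
  set A := shifted H with hA_def
  set c := singularCoeff A g with hc_def
  set α := singularCoeff A u with hα_def
  set S := univ.filter (fun i : Fin N => 4 * Real.sqrt (singularValueSq A i) - 3 = lam) with hS
  -- λ ≥ −1 (from ‖H‖ ≤ 1 applied to the unit vector g)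
  have hl1 : -1 ≤ lam := by
    have h := (abs_le.mp (abs_quadForm_le hH1 g)).1
    rw [hg, dotProduct_smul, smul_eq_mul, ← normSq_eq_dot, hg1] at h
    linarith
  -- c_i = 0 off S (eigenvectors of the symmetric H for different eigenvalues are orthogonal)
  have hc0 : ∀ i, i ∉ S → c i = 0 := by
    intro i hi
    have hne : 4 * Real.sqrt (singularValueSq A i) - 3 ≠ lam := by
      simpa [hS] using hi
    have hv := hamiltonian_mulVec_col hH hH1 i
    have h1 : (H *ᵥ rightSingularVec A i) ⬝ᵥ g = rightSingularVec A i ⬝ᵥ (H *ᵥ g) :=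
      dot_mulVec_symm hH _ _
    rw [hv, hg, smul_dotProduct, dotProduct_smul, smul_eq_mul, smul_eq_mul] at h1
    have h2 : (4 * Real.sqrt (singularValueSq A i) - 3 - lam) * (rightSingularVec A i ⬝ᵥ g) = 0 := by
      linarith
    rcases mul_eq_zero.mp h2 with h3 | h3
    · exact absurd (sub_eq_zero.mp h3) hne
    · rw [hc_def, singularCoeff_eq_dot]; exact h3
  -- Parseval: ⟨g,u⟩ = ∑ c_i α_i
  have hpar : g ⬝ᵥ u = ∑ i, c i * α i := by
    have hVV := rightSingularMatrix_mul_transpose_self A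
    have : u = rightSingularMatrix A *ᵥ ((rightSingularMatrix A)ᵀ *ᵥ u) := by
      rw [mulVec_mulVec, hVV, one_mulVec]
    conv_lhs => rw [this]
    rw [dotProduct_mulVec, ← mulVec_transpose]
    rfl
  -- restrict to S
  have hparS : g ⬝ᵥ u = ∑ i ∈ S, c i * α i := by
    rw [hpar, ← Finset.sum_subset (Finset.subset_univ S)]
    intro i _ hi
    rw [hc0 i hi, zero_mul]
  -- ∑_S c_i² ≤ 1
  have hcS : ∑ i ∈ S, c i ^ 2 ≤ 1 := by
    calc ∑ i ∈ S, c i ^ 2 ≤ ∑ i, c i ^ 2 :=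
          Finset.sum_le_sum_of_subset_of_nonneg (Finset.subset_univ S) fun i _ _ => sq_nonneg _
      _ = normSq g := sum_singularCoeff_sq A g
      _ = 1 := hg1
  -- Cauchy–Schwarz
  have hCS : (g ⬝ᵥ u) ^ 2 ≤ ∑ i ∈ S, α i ^ 2 := by
    rw [hparS]
    calc (∑ i ∈ S, c i * α i) ^ 2 ≤ (∑ i ∈ S, c i ^ 2) * ∑ i ∈ S, α i ^ 2 :=
          sum_mul_sq_le_sq_mul_sq S c α
      _ ≤ 1 * ∑ i ∈ S, α i ^ 2 :=
          mul_le_mul_of_nonneg_right hcS (Finset.sum_nonneg fun i _ => sq_nonneg _)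
      _ = ∑ i ∈ S, α i ^ 2 := one_mul _
  have hδ2 : δ ^ 2 ≤ (g ⬝ᵥ u) ^ 2 := by nlinarith
  -- S ⊆ window
  have hSW : S ⊆ univ.filter (fun i => 1 / 2 ≤ Real.sqrt (singularValueSq A i) ∧
      Real.sqrt (singularValueSq A i) ≤ (3 + a) / 4) := by
    intro i hi
    have heq : 4 * Real.sqrt (singularValueSq A i) - 3 = lam := by simpa [hS] using hi
    simp only [Finset.mem_filter, Finset.mem_univ, true_and]
    constructor <;> linarith
  calc δ ^ 2 ≤ ∑ i ∈ S, α i ^ 2 := hδ2.trans hCS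
    _ ≤ _ := Finset.sum_le_sum_of_subset_of_nonneg hSW fun i _ _ => sq_nonneg _

/-! ### Proposition 1: the decision procedure and its guarantee -/

/-- **GL22 Proposition 1 (gapped guided local Hamiltonian decision, classically) — real case, the
algorithm with its guarantee.**  Input: a real symmetric `H` with `‖H‖ ≤ 1` (`‖Hx‖² ≤ ‖x‖²`),
the Def.-2 oracles of the `s`-sparse `A = (H+3I)/4` (printed: `s = m2^k + 1`), `ζ`-sampling
access to `u` with `‖u‖ ≤ 1` (`ζ ≤ δ²/56`; printed `ζ = 0`), numbers `−1 ≤ a < b ≤ 1`,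
`δ ∈ (0,1]`, and two sign polynomials of the cited kind with `η = 1/4`, `η = (b−a)/8`,
`ξ = 2χ/5`, `χ = δ²/3`.  Procedure ("simply use the algorithm of Theorem 4 for
`SV(s,1/2,(3+a)/4,1/2,(b−a)/4,δ,ζ)` on input `((H+3I)/4, u)`"): `q` medians of `x`-sample means
of the `EST` estimator for `uᵀP(√(AᵀA))u` with the Lemma-4 polynomial; answer "`λ_H ≤ a`" iff the
median exceeds `δ²/2`.  Guarantee: if `λ_H ≤ a` — witnessed by a unit eigenvector `g` of an
eigenvalue `λ ≤ a` with `⟨g,u⟩ ≥ δ` (promise (i) `‖Π_H u‖ ≥ δ` gives `g = Π_H u/‖Π_H u‖`) — the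
outcomes answering "`≤ δ²/2`" have weight `≤ η`; if `λ_H ≥ b` (`xᵀHx ≥ b‖x‖²` for all `x`) the
outcomes answering "`> δ²/2`" have weight `≤ η`; here `x ≥ 1024/(δ²/7)²`, `q ≥ 8 ln(1/η)`.
[cite: GharibianLegall2022, §4.3 Proposition 1 and its proof] -/
theorem guidedLocalHamiltonian_decision {s d : ℕ} (H : Matrix (Fin N) (Fin N) ℝ) (hH : Hᵀ = H)
    (hH1 : ∀ x : Fin N → ℝ, normSq (H *ᵥ x) ≤ normSq x) (u : Fin N → ℝ) (hu : normSq u ≤ 1)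
    {rowO colO : SparseQuery.RowOracle (Fin N) (Fin N) ℝ} (hr : rowO.Lists (shifted H))
    (hc : colO.Lists (shifted H)ᵀ) (hrw : rowO.Width s) (hcw : colO.Width s)
    {ζ : ℝ} (S : ZetaSampling ζ u) (h0 : 0 ≤ ζ)
    {a b δ : ℝ} (ha : -1 ≤ a) (hab : a < b) (hb : b ≤ 1) (hδ : 0 < δ) (hδ1 : δ ≤ 1)
    (hζ : ζ ≤ δ ^ 2 / 56)
    {p₁ p₂ : ℝ[X]} (h₁ : SignApprox (1 / 4) (2 * (δ ^ 2 / 3) / 5) p₁)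
    (h₂ : SignApprox ((b - a) / 8) (2 * (δ ^ 2 / 3) / 5) p₂)
    (hd : max p₁.natDegree p₂.natDegree ≤ 2 * d + 1)
    {η : ℝ} (hη : 0 < η) {x q : ℕ} (hx : 1024 / (δ ^ 2 / 7) ^ 2 ≤ (x : ℝ)) (hq : 0 < q)
    (hqη : 8 * Real.log (1 / η) ≤ q) (med : (Fin q → Fin x → Fin N) → ℝ)
    (hmed : ∀ ω, IsMedian
      (fun i => blockMean (S.est (SparseQuery.recEvalPoly
        (evenCoeffs (windowPoly (1 / 2) ((3 + a) / 4) (1 / 2) ((b - a) / 4)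
          (2 * (δ ^ 2 / 3) / 5) p₁ p₂) d)
        (rowO.gram colO) u)) (ω i)) (med ω)) :
    ((∃ lam : ℝ, lam ≤ a ∧ ∃ g : Fin N → ℝ, H *ᵥ g = lam • g ∧ normSq g = 1 ∧ δ ≤ g ⬝ᵥ u) →
      ∑ ω ∈ univ.filter (fun ω : Fin q → Fin x → Fin N => med ω ≤ δ ^ 2 / 2),
        ∏ i, iidWeight S.p (ω i) ≤ η)
    ∧ ((∀ y : Fin N → ℝ, b * normSq y ≤ y ⬝ᵥ (H *ᵥ y)) →
      ∑ ω ∈ univ.filter (fun ω : Fin q → Fin x → Fin N => δ ^ 2 / 2 < med ω),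
        ∏ i, iidWeight S.p (ω i) ≤ η) := by
  have hW : WindowHyp (1 / 2) ((3 + a) / 4) (1 / 2) ((b - a) / 4) (2 * (δ ^ 2 / 3) / 5) p₁ p₂ :=
    { hθ₁ := by norm_num
      hθ₂ := by linarith
      ht₁ := le_refl _
      ht₁₂ := by linarith
      ht₂ := by linarith
      hξ := by positivity
      h₁ := by rw [show (1 / 2 : ℝ) / 2 = 1 / 4 by norm_num]; exact h₁
      h₂ := by rw [show (b - a) / 4 / 2 = (b - a) / 8 by ring]; exact h₂ }
  obtain ⟨hi, hii⟩ := singularValue_decision_of_signApprox (shifted H) u hr hc hrw hcw S h0 hδ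
    hδ1 hζ (normSq_shifted_mulVec_le hH1) hu hW hd hη hx hq hqη med hmed
  refine ⟨fun hlo => hi ?_, fun hhi => hii fun i => no_singularValue_in_gap hH hH1 hhi i⟩
  obtain ⟨lam, hla, g, hg, hg1, hgu⟩ := hlo
  exact window_weight_ge hH hH1 u hδ.le hla hg hg1 hgu

end glh

/-! ### Theorem 1 assembled: `2r` independent runs of Proposition 1's procedure and the scan

> *Proof of Theorem 1.* … For some integer `r = O(1)` that will be fixed later, decompose the
> interval `[−1,1]` into `2r` intervals, each of length `1/r`.  The `i`-th interval is
> `[(i−r−1)/r, (i−r)/r]`, for each `i ∈ {1,…,2r}`.  For each `i ∈ {1,…,2r}`, we apply the algorithm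
> of Proposition 1 (which we denote below by Algorithm `𝒞`) to solve the problem `GLH(k,aᵢ,bᵢ,δ)`
> on input `(H,u)` with `aᵢ = (i−r−1)/r` and `bᵢ = (i−r)/r`.  With probability at least
> `1 − 1/exp(n)`, Algorithm `𝒞` never errs during the `2r` iterations. … Taking `r = 2/ε` thus
> guarantees that we get an `ε`-additive-approximation of `λ_H`.

Here: the `2r` runs use independent samples `ω = (ω_j)_{j<2r}` (product weight); run `j` (the
paper's `i = j+1`) errs on an outcome set of weight `≤ η` by `guidedLocalHamiltonian_decision`
(in whichever of the two promise regimes `λ_H` lies for `(a_j,b_j)`; on neither, no answer is an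
error), so by the union bound all runs are correct off a set of weight `≤ 2rη`, and there the
scan estimate `(#{j : answer "λ_H ≥ b_j"} − r)/r` is within `1/r` of `λ_H`
(`thresholdScan_estimate`).  The ground energy `λ_H` with promise (i) enters through a unit ground
vector `g` (`Hg = λ_H g`, `⟨g,u⟩ ≥ δ`) together with minimality `xᵀHx ≥ λ_H‖x‖²`. -/

section theoremOne

variable {N : ℕ}

/-- The lower threshold `a = (i−r−1)/r` of the `i`-th scan interval (`i = j+1`, `j : Fin (2r)`).
[cite: GharibianLegall2022, §4.3 proof of Theorem 1 ("`aᵢ = (i−r−1)/r`")] -/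
def scanLo (r : ℕ) (j : Fin (2 * r)) : ℝ := (((j : ℕ) : ℝ) - r) / r

/-- The upper threshold `b = (i−r)/r` of the `i`-th scan interval (`i = j+1`).
[cite: GharibianLegall2022, §4.3 proof of Theorem 1 ("`bᵢ = (i−r)/r`")] -/
def scanHi (r : ℕ) (j : Fin (2 * r)) : ℝ := (((j : ℕ) : ℝ) + 1 - r) / r

/-- The Lemma-4 polynomial of run `j`: `(t₁,t₂,θ₁,θ₂) = (1/2, (3+a_j)/4, 1/2, (b_j−a_j)/4)`,
`ξ = 2χ/5`, `χ = δ²/3`. [cite: GharibianLegall2022, §4.3 proofs of Proposition 1 and Theorem 1] -/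
def scanPoly (r : ℕ) (δ : ℝ) (p₁ p₂ : ℝ[X]) (j : Fin (2 * r)) : ℝ[X] :=
  windowPoly (1 / 2) ((3 + scanLo r j) / 4) (1 / 2) ((scanHi r j - scanLo r j) / 4)
    (2 * (δ ^ 2 / 3) / 5) p₁ p₂

/-- `−1 ≤ a_j < b_j ≤ 1` and `b_j − a_j = 1/r`. [cite: GharibianLegall2022, §4.3 proof of
Theorem 1 ("`2r` intervals, each of length `1/r`")] -/
theorem scan_thresholds {r : ℕ} (hr : 0 < r) (j : Fin (2 * r)) :
    -1 ≤ scanLo r j ∧ scanLo r j < scanHi r j ∧ scanHi r j ≤ 1 ∧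
      scanHi r j - scanLo r j = 1 / r := by
  have hr' : (0 : ℝ) < r := Nat.cast_pos.2 hr
  have hj : ((j : ℕ) : ℝ) + 1 ≤ 2 * r := by
    have := j.isLt
    exact_mod_cast Nat.succ_le_of_lt this
  have hj0 : (0 : ℝ) ≤ ((j : ℕ) : ℝ) := Nat.cast_nonneg _
  refine ⟨?_, ?_, ?_, ?_⟩
  · rw [scanLo, le_div_iff₀ hr']; linarith
  · rw [scanLo, scanHi]; exact div_lt_div_of_pos_right (by linarith) hr'
  · rw [scanHi, div_le_one hr']; linarith
  · rw [scanHi, scanLo]; field_simp; ring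

/-- Union bound for nonnegative weights over a finite family of events. [folklore] -/
private theorem sum_filter_exists_le {ι Ω' : Type*} [Fintype ι] [Fintype Ω'] (W : Ω' → ℝ)
    (hW : ∀ ω, 0 ≤ W ω) (P : ι → Ω' → Prop) [∀ j, DecidablePred (P j)]
    [DecidablePred fun ω => ∃ j, P j ω] :
    ∑ ω ∈ univ.filter (fun ω => ∃ j, P j ω), W ω ≤ ∑ j, ∑ ω ∈ univ.filter (P j), W ω := by
  rw [Finset.sum_filter]
  simp_rw [Finset.sum_filter]
  rw [Finset.sum_comm]
  refine Finset.sum_le_sum fun ω _ => ?_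
  have hterm : ∀ j', 0 ≤ (if P j' ω then W ω else 0) := fun j' => by
    split_ifs
    · exact hW ω
    · exact le_refl _
  split_ifs with h
  · obtain ⟨j, hj⟩ := h
    calc W ω = (if P j ω then W ω else 0) := by rw [if_pos hj]
      _ ≤ ∑ j', (if P j' ω then W ω else 0) := Finset.single_le_sum (fun j' _ => hterm j') (mem_univ j)
  · exact Finset.sum_nonneg fun j' _ => hterm j'

/-- Marginal of one coordinate under a product weight: the weight of `{ω : ω_j ∈ E}` is the weight
of `E`. [folklore] -/
private theorem sum_filter_coord {s : ℕ} {B : Type*} [Fintype B] {p : B → ℝ} (hp : ∑ b, p b = 1)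
    (E : B → Prop) [DecidablePred E] (t : Fin s) :
    ∑ ω ∈ univ.filter (fun ω : Fin s → B => E (ω t)), iidWeight p ω
      = ∑ b ∈ univ.filter E, p b := by
  rw [Finset.sum_filter, Finset.sum_filter]
  have h := sum_iidWeight_mul_apply hp (fun b => if E b then (1 : ℝ) else 0) t
  simp only [mul_ite, mul_one, mul_zero] at h
  exact h

/-- **GL22 Theorem 1 — the classical `GLHest` algorithm assembled (real case): `2r` independent
runs of Proposition 1's procedure on the scan thresholds, then the interval scan.**  With `H`,
`u`, the oracles of `A = (H+3I)/4`, `ζ`-sampling access, `δ`, the two sign polynomials (now with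
`η = 1/4` and `η = 1/(8r)`, shared by all runs), `x ≥ 1024/(δ²/7)²` samples per mean and
`q ≥ 8 ln(1/η)` means per run as in `guidedLocalHamiltonian_decision`; `λ_H` the ground energy,
entered through a unit ground vector `g` (`Hg = λ_H g`, `‖g‖ = 1`, `⟨g,u⟩ ≥ δ` — promise (i)) and
minimality (`xᵀHx ≥ λ_H‖x‖²`).  Run `j < 2r` answers "`λ_H ≥ b_j`" iff its median is `≤ δ²/2`;
output `(#{j : "≥"} − r)/r`.  Guarantee: the outcomes `ω = (ω_j)_j` on which the output is NOT
within `1/r` of `λ_H` have total product weight `≤ 2r·η` ("With probability at least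
`1 − 1/exp(n)`, Algorithm `𝒞` never errs during the `2r` iterations … we get an
`ε`-additive-approximation of `λ_H`", `r ≥ 1/ε`).
[cite: GharibianLegall2022, §1.2 Theorem 1 and §4.3 proof of Theorem 1 from Proposition 1] -/
theorem groundEnergy_estimate {s d r : ℕ} (hr0 : 0 < r) (H : Matrix (Fin N) (Fin N) ℝ)
    (hH : Hᵀ = H) (hH1 : ∀ x : Fin N → ℝ, normSq (H *ᵥ x) ≤ normSq x) (u : Fin N → ℝ)
    (hu : normSq u ≤ 1) {rowO colO : SparseQuery.RowOracle (Fin N) (Fin N) ℝ}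
    (hro : rowO.Lists (shifted H)) (hco : colO.Lists (shifted H)ᵀ) (hrw : rowO.Width s)
    (hcw : colO.Width s) {ζ : ℝ} (S : ZetaSampling ζ u) (h0 : 0 ≤ ζ)
    {δ : ℝ} (hδ : 0 < δ) (hδ1 : δ ≤ 1) (hζ : ζ ≤ δ ^ 2 / 56)
    {lam : ℝ} {g : Fin N → ℝ} (hg : H *ᵥ g = lam • g) (hg1 : normSq g = 1) (hgu : δ ≤ g ⬝ᵥ u)
    (hmin : ∀ y : Fin N → ℝ, lam * normSq y ≤ y ⬝ᵥ (H *ᵥ y))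
    {p₁ p₂ : ℝ[X]} (h₁ : SignApprox (1 / 4) (2 * (δ ^ 2 / 3) / 5) p₁)
    (h₂ : SignApprox (1 / (8 * r)) (2 * (δ ^ 2 / 3) / 5) p₂)
    (hd : max p₁.natDegree p₂.natDegree ≤ 2 * d + 1)
    {η : ℝ} (hη : 0 < η) {x q : ℕ} (hx : 1024 / (δ ^ 2 / 7) ^ 2 ≤ (x : ℝ)) (hq : 0 < q)
    (hqη : 8 * Real.log (1 / η) ≤ q) (med : Fin (2 * r) → (Fin q → Fin x → Fin N) → ℝ)
    (hmed : ∀ j ω, IsMedian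
      (fun i => blockMean (S.est (SparseQuery.recEvalPoly (evenCoeffs (scanPoly r δ p₁ p₂ j) d)
        (rowO.gram colO) u)) (ω i)) (med j ω)) :
    ∑ ω ∈ univ.filter (fun ω : Fin (2 * r) → (Fin q → Fin x → Fin N) =>
        1 / (r : ℝ) < |(((univ.filter fun j => med j (ω j) ≤ δ ^ 2 / 2).card : ℝ) - r) / r - lam|),
      ∏ j, ∏ i, iidWeight S.p (ω j i) ≤ 2 * r * η := by
  classical
  -- the weight of one run's outcome and of the 2r-tuple
  set w : (Fin q → Fin x → Fin N) → ℝ := fun β => ∏ i, iidWeight S.p (β i) with hw_def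
  have hw_eq : w = iidWeight (iidWeight S.p) := by
    funext β; simp [hw_def, iidWeight]
  have hw1 : ∑ β, w β = 1 := by
    rw [hw_eq]; exact sum_iidWeight (sum_iidWeight S.sum_p)
  have hw0 : ∀ β, 0 ≤ w β := fun β =>
    prod_nonneg fun i _ => iidWeight_nonneg S.p_nonneg _
  have hWprod : ∀ ω : Fin (2 * r) → (Fin q → Fin x → Fin N),
      ∏ j, ∏ i, iidWeight S.p (ω j i) = iidWeight w ω := fun ω => rfl
  simp_rw [hWprod]
  have hW0 : ∀ ω : Fin (2 * r) → (Fin q → Fin x → Fin N), 0 ≤ iidWeight w ω :=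
    fun ω => iidWeight_nonneg hw0 ω
  -- λ ∈ [−1,1]
  have hl : -1 ≤ lam ∧ lam ≤ 1 := by
    have h := abs_le.mp (abs_quadForm_le hH1 g)
    rw [hg, dotProduct_smul, smul_eq_mul, ← show normSq g = g ⬝ᵥ g by
      simp [normSq, dotProduct, sq], hg1] at h
    constructor <;> linarith [h.1, h.2]
  -- the error event of run j
  set Ebad : Fin (2 * r) → (Fin q → Fin x → Fin N) → Prop := fun j β =>
    (lam ≤ scanLo r j ∧ med j β ≤ δ ^ 2 / 2) ∨ (scanHi r j ≤ lam ∧ δ ^ 2 / 2 < med j β)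
    with hEbad
  -- each run errs with weight ≤ η (Proposition 1)
  have hrun : ∀ j, ∑ β ∈ univ.filter (Ebad j), w β ≤ η := by
    intro j
    obtain ⟨ha, hab, hb, hdiff⟩ := scan_thresholds hr0 j
    have h₂' : SignApprox ((scanHi r j - scanLo r j) / 8) (2 * (δ ^ 2 / 3) / 5) p₂ := by
      rw [hdiff, show (1 / (r : ℝ)) / 8 = 1 / (8 * r) by ring]
      exact h₂
    have hP := guidedLocalHamiltonian_decision (d := d) H hH hH1 u hu hro hco hrw hcw S h0 ha hab
      hb hδ hδ1 hζ h₁ h₂' hd hη hx hq hqη (med j) (fun ω => by simpa only [scanPoly] using hmed j ω)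
    rcases le_or_gt lam (scanLo r j) with hlo | hlo
    · -- regime λ ≤ a_j: errors are the answers "≥ b_j"
      have hsub : univ.filter (Ebad j) ⊆ univ.filter (fun β => med j β ≤ δ ^ 2 / 2) := by
        intro β hβ
        simp only [hEbad, Finset.mem_filter, Finset.mem_univ, true_and] at hβ ⊢
        rcases hβ with h | h
        · exact h.2
        · exfalso; linarith [h.1]
      refine (Finset.sum_le_sum_of_subset_of_nonneg hsub fun β _ _ => hw0 β).trans ?_
      exact hP.1 ⟨lam, hlo, g, hg, hg1, hgu⟩
    · rcases le_or_gt (scanHi r j) lam with hhi | hhi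
      · -- regime λ ≥ b_j: errors are the answers "≤ a_j"
        have hsub : univ.filter (Ebad j) ⊆ univ.filter (fun β => δ ^ 2 / 2 < med j β) := by
          intro β hβ
          simp only [hEbad, Finset.mem_filter, Finset.mem_univ, true_and] at hβ ⊢
          rcases hβ with h | h
          · exfalso; linarith [h.1]
          · exact h.2
        refine (Finset.sum_le_sum_of_subset_of_nonneg hsub fun β _ _ => hw0 β).trans ?_
        refine hP.2 fun y => ?_
        have := hmin y
        nlinarith [normSq_nonneg y]
      · -- λ strictly inside (a_j, b_j): no answer is an error
        have hempty : univ.filter (Ebad j) = ∅ := by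
          refine Finset.filter_false_of_mem fun β _ => ?_
          simp only [hEbad]
          rintro (⟨h, -⟩ | ⟨h, -⟩) <;> linarith
        rw [hempty, Finset.sum_empty]
        exact hη.le
  -- off the union of the error events the scan estimate is 1/r-accurate
  have hsub : univ.filter (fun ω : Fin (2 * r) → (Fin q → Fin x → Fin N) =>
      1 / (r : ℝ) < |(((univ.filter fun j => med j (ω j) ≤ δ ^ 2 / 2).card : ℝ) - r) / r - lam|)
      ⊆ univ.filter (fun ω => ∃ j, Ebad j (ω j)) := by
    intro ω hω
    simp only [Finset.mem_filter, Finset.mem_univ, true_and] at hω ⊢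
    by_contra hno
    have hno' : ∀ j, ¬ Ebad j (ω j) := not_exists.mp hno
    have hest := thresholdScan_estimate hr0 hl.1 hl.2 (fun j => med j (ω j) ≤ δ ^ 2 / 2)
      (fun j hja hge => hno' j (Or.inl ⟨(show lam ≤ scanLo r j from hja), hge⟩))
      (fun j hjb => by
        by_contra hlt
        exact hno' j (Or.inr ⟨(show scanHi r j ≤ lam from hjb), not_le.mp hlt⟩))
    linarith
  -- union bound
  calc ∑ ω ∈ univ.filter (fun ω : Fin (2 * r) → (Fin q → Fin x → Fin N) => 1 / (r : ℝ) <
          |(((univ.filter fun j => med j (ω j) ≤ δ ^ 2 / 2).card : ℝ) - r) / r - lam|),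
          iidWeight w ω
      ≤ ∑ ω ∈ univ.filter (fun ω => ∃ j, Ebad j (ω j)), iidWeight w ω :=
        Finset.sum_le_sum_of_subset_of_nonneg hsub fun ω _ _ => hW0 ω
    _ ≤ ∑ j, ∑ ω ∈ univ.filter (fun ω => Ebad j (ω j)), iidWeight w ω :=
        sum_filter_exists_le _ hW0 (fun j ω => Ebad j (ω j))
    _ = ∑ j, ∑ β ∈ univ.filter (Ebad j), w β :=
        Finset.sum_congr rfl fun j _ => sum_filter_coord hw1 (Ebad j) j
    _ ≤ ∑ _j : Fin (2 * r), η := Finset.sum_le_sum fun j _ => hrun j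
    _ = 2 * r * η := by simp [Finset.sum_const, Finset.card_univ, Fintype.card_fin]

end theoremOne

/-! ### "`(H+3I)/4` is `(m2^k+1)`-sparse": the Def.-2 oracle of the shifted matrix from that of `H`

> "Since `H` is a `k`-local Hamiltonian … `H` is `m2^k`-sparse. … The Hermitian matrix
> `(H+3I)/4` is thus `(m2^k+1)`-sparse" — i.e. query-access to `(H+3I)/4` is obtained from
> query-access to `H` by rescaling the listed entries by `1/4` and adding the diagonal entry.

With this the procedures above take the PRINTED input (Def.-2 query-access to `H`) rather than
query-access to `(H+3I)/4`. -/

section oracle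

variable {N : ℕ}

/-- Off-diagonal entries of `(H+3I)/4`. [cite: GharibianLegall2022, §4.3 proof of Proposition 1] -/
theorem shifted_apply_ne (H : Matrix (Fin N) (Fin N) ℝ) {i k : Fin N} (h : k ≠ i) :
    shifted H i k = H i k / 4 := by
  simp [shifted, Matrix.smul_apply, Matrix.add_apply, Matrix.one_apply_ne (Ne.symm h)]
  ring

/-- Diagonal entries of `(H+3I)/4`. [cite: GharibianLegall2022, §4.3 proof of Proposition 1] -/
theorem shifted_apply_self (H : Matrix (Fin N) (Fin N) ℝ) (i : Fin N) :
    shifted H i i = (H i i + 3) / 4 := by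
  simp [shifted, Matrix.smul_apply, Matrix.add_apply]
  ring

/-- **The Def.-2 row oracle of `(H+3I)/4` built from a Def.-2 row oracle of `H`**: row `i ↦`
the diagonal pair `(i, (H_{ii}+3)/4)` followed by the listed off-diagonal pairs of `H` with values
divided by `4` (one more entry per row: "`(m2^k+1)`-sparse").
[cite: GharibianLegall2022, §4.3 proof of Proposition 1 ("The Hermitian matrix `(H+3I)/4` is thus
`(m2^k+1)`-sparse")] -/
def shiftedOracle (H : Matrix (Fin N) (Fin N) ℝ) (O : SparseQuery.RowOracle (Fin N) (Fin N) ℝ) :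
    SparseQuery.RowOracle (Fin N) (Fin N) ℝ :=
  ⟨fun i => (i, (H i i + 3) / 4) ::
    ((O.entries i).filter (fun e => e.1 ≠ i)).map (fun e => (e.1, e.2 / 4))⟩

/-- The derived oracle lists the rows of `(H+3I)/4` (Def. 2: correct values, distinct positions,
every non-zero entry). [cite: GharibianLegall2022, §4.3 proof of Proposition 1; §2.1 Definition 2] -/
theorem shiftedOracle_lists {H : Matrix (Fin N) (Fin N) ℝ}
    {O : SparseQuery.RowOracle (Fin N) (Fin N) ℝ} (hO : O.Lists H) :
    (shiftedOracle H O).Lists (shifted H) where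
  value i e he := by
    simp only [shiftedOracle, List.mem_cons, List.mem_map, List.mem_filter] at he
    rcases he with rfl | ⟨e', ⟨he', hne⟩, rfl⟩
    · exact (shifted_apply_self H i).symm
    · have hne' : e'.1 ≠ i := by simpa using hne
      rw [shifted_apply_ne H hne', hO.value i e' he']
  nodup i := by
    simp only [shiftedOracle, List.map_cons, List.map_map, List.nodup_cons]
    constructor
    · intro hi
      simp only [List.mem_map, List.mem_filter, Function.comp_apply] at hi
      obtain ⟨e, ⟨-, hne⟩, he⟩ := hi
      have : e.1 ≠ i := by simpa using hne
      exact this he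
    · have hsub : List.Sublist ((O.entries i).filter fun e => e.1 ≠ i) (O.entries i) :=
        List.filter_sublist
      have h1 := (hsub.map Prod.fst).nodup (hO.nodup i)
      have heq : List.map (Prod.fst ∘ fun e : Fin N × ℝ => (e.1, e.2 / 4))
          ((O.entries i).filter fun e => e.1 ≠ i)
          = List.map Prod.fst ((O.entries i).filter fun e => e.1 ≠ i) :=
        List.map_congr_left fun e _ => rfl
      rw [heq]
      exact h1
  cover i k hk := by
    simp only [shiftedOracle, List.map_cons, List.map_map, List.mem_cons, List.mem_map,
      List.mem_filter, Function.comp_apply]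
    by_cases hki : k = i
    · exact Or.inl hki
    · right
      have hH : H i k ≠ 0 := by
        rw [shifted_apply_ne H hki] at hk
        intro h0; apply hk; rw [h0]; simp
      have hmem := hO.cover i k hH
      rw [List.mem_map] at hmem
      obtain ⟨e, he, hek⟩ := hmem
      refine ⟨e, ⟨he, ?_⟩, hek⟩
      simpa [hek] using hki

/-- The derived oracle has width `s + 1` when `H`'s has width `s` ("`(m2^k+1)`-sparse").
[cite: GharibianLegall2022, §4.3 proof of Proposition 1] -/
theorem shiftedOracle_width {H : Matrix (Fin N) (Fin N) ℝ}
    {O : SparseQuery.RowOracle (Fin N) (Fin N) ℝ} {s : ℕ} (hOw : O.Width s) :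
    (shiftedOracle H O).Width (s + 1) := by
  intro i
  simp only [shiftedOracle, List.length_cons, List.length_map]
  have h1 := List.length_filter_le (fun e : Fin N × ℝ => decide (e.1 ≠ i)) (O.entries i)
  have h2 := hOw i
  omega

/-- **GL22 Theorem 1 assembled, from the PRINTED inputs**: as `groundEnergy_estimate`, but taking
Def.-2 query-access to the symmetric `s`-sparse `H` itself; the procedure queries `(H+3I)/4`
through `shiftedOracle` (width `s+1`), for rows and — `H` being symmetric — for columns alike.
[cite: GharibianLegall2022, §1.2 Theorem 1, §4.3 Proposition 1 and proof of Theorem 1] -/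
theorem groundEnergy_estimate_of_hamiltonianOracle {s d r : ℕ} (hr0 : 0 < r)
    (H : Matrix (Fin N) (Fin N) ℝ) (hH : Hᵀ = H)
    (hH1 : ∀ x : Fin N → ℝ, normSq (H *ᵥ x) ≤ normSq x) (u : Fin N → ℝ) (hu : normSq u ≤ 1)
    {O : SparseQuery.RowOracle (Fin N) (Fin N) ℝ} (hO : O.Lists H) (hOw : O.Width s)
    {ζ : ℝ} (S : ZetaSampling ζ u) (h0 : 0 ≤ ζ)
    {δ : ℝ} (hδ : 0 < δ) (hδ1 : δ ≤ 1) (hζ : ζ ≤ δ ^ 2 / 56)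
    {lam : ℝ} {g : Fin N → ℝ} (hg : H *ᵥ g = lam • g) (hg1 : normSq g = 1) (hgu : δ ≤ g ⬝ᵥ u)
    (hmin : ∀ y : Fin N → ℝ, lam * normSq y ≤ y ⬝ᵥ (H *ᵥ y))
    {p₁ p₂ : ℝ[X]} (h₁ : SignApprox (1 / 4) (2 * (δ ^ 2 / 3) / 5) p₁)
    (h₂ : SignApprox (1 / (8 * r)) (2 * (δ ^ 2 / 3) / 5) p₂)
    (hd : max p₁.natDegree p₂.natDegree ≤ 2 * d + 1)
    {η : ℝ} (hη : 0 < η) {x q : ℕ} (hx : 1024 / (δ ^ 2 / 7) ^ 2 ≤ (x : ℝ)) (hq : 0 < q)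
    (hqη : 8 * Real.log (1 / η) ≤ q) (med : Fin (2 * r) → (Fin q → Fin x → Fin N) → ℝ)
    (hmed : ∀ j ω, IsMedian
      (fun i => blockMean (S.est (SparseQuery.recEvalPoly (evenCoeffs (scanPoly r δ p₁ p₂ j) d)
        ((shiftedOracle H O).gram (shiftedOracle H O)) u)) (ω i)) (med j ω)) :
    ∑ ω ∈ univ.filter (fun ω : Fin (2 * r) → (Fin q → Fin x → Fin N) =>
        1 / (r : ℝ) < |(((univ.filter fun j => med j (ω j) ≤ δ ^ 2 / 2).card : ℝ) - r) / r - lam|),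
      ∏ j, ∏ i, iidWeight S.p (ω j i) ≤ 2 * r * η := by
  have hro : (shiftedOracle H O).Lists (shifted H) := shiftedOracle_lists hO
  have hco : (shiftedOracle H O).Lists (shifted H)ᵀ := by
    rw [shifted_transpose hH]; exact hro
  exact groundEnergy_estimate hr0 H hH hH1 u hu hro hco (shiftedOracle_width hOw)
    (shiftedOracle_width hOw) S h0 hδ hδ1 hζ hg hg1 hgu hmin h₁ h₂ hd hη hx hq hqη med hmed

end oracle

end SampleQuery

end Literature.Computability.QuantumComplexity

end
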